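import Mathlib
import Summits.CriticalPhenomena.PercolationContinuityZ3.Theorems.PercNearOneGluingNoHeavyLowerTailOrderedDifferencesGoldenCharTwo
import Summits.CriticalPhenomena.PercolationContinuityZ3.Theorems.PercNearOneGluingNoHeavyLowerTailOrderedDifferencesQuadraticReduction

/-!
# A tangential certificate at the RAMIFIED prime `5`: no Jordan chain at `θ = 3` over `𝔽₅` ⟹ (C0) at the golden ratio

Helper file for crux `stmt-CriticalPhenomena-4575` (`NoHeavyLowerTail`, route `PercNearOneGluingNoHeavy`), new-inequality factory
seat `prim-ineq-gen-3` (gen 30).  Everything here is PROVED; no definitions.  Imports Mathlib and two sibling helper files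
(`…GoldenCharTwo`: `int_eq_zero_of_golden`, `exists_int_add_int_mul_of_mem_adjoin`; `…QuadraticReduction`: `quad_mul_expand`).

Notation (memo `run/shared/lean/prim/prim-ineq-gen-3/CONJECTURE-P2F2.md`): the pencil rows of `𝒜` at `t` are
`A ↦ (E ↦ [E ⊆ A] + t [E ∩ A = ∅])`, `E ∈ 𝒜 \\ 𝒜`; write `U(t) = Z + tY`.  LEMMA R_p (gens 28–30, `…Specialization`): a root `θ`
of the minimal polynomial `f` of `t` in a field of characteristic `p` with `rank U(θ) = |𝒜|` certifies `rank U(t) = |𝒜|`.  For the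
golden ratio the prime `5` is RAMIFIED, `X² − X − 1 ≡ (X − 3)² (mod 5)`, and the plain certificate `rank_{𝔽₅} U(3) = |𝒜|` FAILS for
some families (the two-tetrahedra family of `…TwoTetra` is singular at `t = 3` over `𝔽₅`).  But ramification gives MORE: reducing a
dependency with unit content modulo `(√5)² = (5)` lands in `𝔽₅[ε]/(ε²)` with `φ ↦ 3 + ε` (`(3 + ε)² = 4 + ε = (3 + ε) + 1`), i.e. in a
LEFT JORDAN CHAIN OF LENGTH TWO of the pencil at `3`:  `v₀ U(3) = 0`, `v₁ U(3) + v₀ Y = 0`, `v₀ ≠ 0`.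

* `golden_sqrt5_mul` — `(2t − 1)(a' + b' t) = (2b' − a') + (2a' + b') t` (division by `√5 = 2t − 1` in `ℤ[t]`).
* `exists_tangent_chain_of_integral_dependency_golden` — ★ an integral dependency `A ↦ a_A + b_A t` (not all zero) at the golden
  ratio yields, over any field of characteristic `5`, a chain `(v₀, v₁)` as above with `v₀ ≠ 0` [while `5 ∣ a_A + 3 b_A` for all
  `A`, divide by `√5`: `(a, b) ↦ ((2b − a)/5, (2a + b)/5)`, the measure `∑ a_A² + b_A²` drops by the factor `5`; then
  `v₀ = a + 3b`, `v₁ = b` (mod 5)].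
* `linearIndependent_pencil_golden_of_tangent_certificate_five` — ★★ THE TANGENTIAL CERTIFICATE: if over a field `F` of
  characteristic `5` the pencil of `𝒜` has no left Jordan chain of length two at `3` (simple eigenvectors at `3` are allowed),
  then the pencil rows of `𝒜` are linearly independent at every `t` with `t² = t + 1` over every field of characteristic `0`.
EVIDENCE for the new CONJECTURE J ("over `𝔽_p`, `p` odd, the pencil is semisimple at every `θ`: no left Jordan chain of length
two"; memo FINDINGS-gen30): the two-tetrahedra family and the Fano plane have SIMPLE eigenvectors at their bad `θ` (chain
structure `[1, 0]`); a census over `p ≤ 23` (random, cyclic, complement-closed and union-closed families, designs) found maximal chain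
length `1` for odd `p` and `2` for `p = 2` (kit j250065/j250066).  The same mechanism at any ramified prime `𝔭` (`e(𝔭|p) ≥ 2`,
`v_𝔭(t − τ) = 1`) turns CONJECTURE J(p) into (C0) for `ζ₃, ζ₅, 2 ± √3, 4 ± √15, (5 ± √21)/2, ζ₁₂, …` — every unit class
ramified at an odd prime.
(prim-ineq-gen-3 gen 30, 2026-08-26.)
-/

namespace Summit.CriticalPhenomena.PercolationContinuityZ3.Theorems

namespace OrderedDifferences

open Finset
open scoped FinsetFamily

variable {α : Type*} [DecidableEq α]

/-- Division by `√5 = 2t − 1` in `ℤ[t]`, `t² = t + 1`: `(2t − 1)(a' + b' t) = (2b' − a') + (2a' + b') t`. -/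
theorem golden_sqrt5_mul {R : Type*} [CommRing R] {t : R} (ht : t * t = t + 1) (a' b' : R) :
    (2 * t - 1) * (a' + b' * t) = (2 * b' - a') + (2 * a' + b') * t := by
  linear_combination (2 * b') * ht

/-- **Integral golden dependency ⟹ Jordan chain of length two at `θ = 3` over characteristic `5`.**  Let `t * t = t + 1` in a
field `K` in which `1, t` are independent over `ℤ`, and let `A ↦ a_A + b_A t` (integers, not all zero) be a dependency of the
pencil rows at `t`.  Then over any field `F` of characteristic `5` there are `v₀ ≠ 0` and `v₁` with
`∑_A v₀(A) ([E ⊆ A] + 3 [E ∩ A = ∅]) = 0` and `∑_A (v₁(A) ([E ⊆ A] + 3 [E ∩ A = ∅]) + v₀(A) [E ∩ A = ∅]) = 0` for every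
`E ∈ 𝒜 \\ 𝒜` [divide `(a, b)` by `√5 = 2t − 1` while `5 ∣ a_A + 3 b_A` for all `A` (descent on `∑ a_A² + b_A²`, which drops by the
factor `5`); then reduce `t ↦ 3 + ε` modulo `ε²`: `v₀ = a + 3b`, `v₁ = b`]. -/
theorem exists_tangent_chain_of_integral_dependency_golden (𝒜 : Finset (Finset α))
    {K : Type*} [Field K] {t : K} (ht : t * t = t + 1)
    (hK : ∀ a b : ℤ, (a : K) + (b : K) * t = 0 → a = 0 ∧ b = 0)
    {F : Type*} [Field F] [CharP F 5]
    (a b : ↥𝒜 → ℤ) (hab : ∃ A, a A ≠ 0 ∨ b A ≠ 0)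
    (hdep : ∀ E ∈ 𝒜 \\ 𝒜, ∑ A : 𝒜, ((a A : K) + (b A : K) * t) *
        ((if E ⊆ (A : Finset α) then (1 : K) else 0) + t * (if Disjoint E (A : Finset α) then (1 : K) else 0)) = 0) :
    ∃ v₀ v₁ : ↥𝒜 → F, v₀ ≠ 0 ∧
      (∀ E ∈ 𝒜 \\ 𝒜, ∑ A : 𝒜, v₀ A *
        ((if E ⊆ (A : Finset α) then (1 : F) else 0) + 3 * (if Disjoint E (A : Finset α) then (1 : F) else 0)) = 0) ∧
      (∀ E ∈ 𝒜 \\ 𝒜, ∑ A : 𝒜, (v₁ A *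
        ((if E ⊆ (A : Finset α) then (1 : F) else 0) + 3 * (if Disjoint E (A : Finset α) then (1 : F) else 0)) +
          v₀ A * (if Disjoint E (A : Finset α) then (1 : F) else 0)) = 0) := by
  classical
  let zI : ↥𝒜 → Finset α → ℤ := fun A E => if E ⊆ (A : Finset α) then 1 else 0
  let yI : ↥𝒜 → Finset α → ℤ := fun A E => if Disjoint E (A : Finset α) then 1 else 0
  -- the two integer identities per column (the case u = v = 1 of `…QuadraticReduction`)
  have hPQ : ∀ E ∈ 𝒜 \\ 𝒜, (∑ A : 𝒜, (a A * zI A E + b A * yI A E) = 0) ∧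
      (∑ A : 𝒜, (a A * yI A E + b A * zI A E + b A * yI A E) = 0) := by
    intro E hE
    have h := hdep E hE
    have e : ∑ A : 𝒜, ((a A : K) + (b A : K) * t) *
        ((if E ⊆ (A : Finset α) then (1 : K) else 0) + t * (if Disjoint E (A : Finset α) then (1 : K) else 0)) =
        ((∑ A : 𝒜, (a A * zI A E + b A * yI A E) : ℤ) : K) +
          ((∑ A : 𝒜, (a A * yI A E + b A * zI A E + b A * yI A E) : ℤ) : K) * t := by
      push_cast [zI, yI]
      rw [sum_mul, ← sum_add_distrib]
      refine sum_congr rfl fun A _ => ?_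
      have := quad_mul_expand (u := (1 : K)) (v := (1 : K)) (t := t) (by rw [ht]; ring) (a A : K) (b A : K)
        (if E ⊆ (A : Finset α) then (1 : K) else 0) (if Disjoint E (A : Finset α) then (1 : K) else 0)
      rw [this]
      ring
    rw [e] at h
    exact hK _ _ h
  -- descent on ∑ (a² + b²)
  suffices H : ∀ (n : ℕ) (a b : ↥𝒜 → ℤ), ∑ A : 𝒜, ((a A) ^ 2 + (b A) ^ 2) ≤ (n : ℤ) → (∃ A, a A ≠ 0 ∨ b A ≠ 0) →
      (∀ E ∈ 𝒜 \\ 𝒜, (∑ A : 𝒜, (a A * zI A E + b A * yI A E) = 0) ∧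
        (∑ A : 𝒜, (a A * yI A E + b A * zI A E + b A * yI A E) = 0)) →
      ∃ v₀ v₁ : ↥𝒜 → F, v₀ ≠ 0 ∧
        (∀ E ∈ 𝒜 \\ 𝒜, ∑ A : 𝒜, v₀ A *
          ((if E ⊆ (A : Finset α) then (1 : F) else 0) + 3 * (if Disjoint E (A : Finset α) then (1 : F) else 0)) = 0) ∧
        (∀ E ∈ 𝒜 \\ 𝒜, ∑ A : 𝒜, (v₁ A *
          ((if E ⊆ (A : Finset α) then (1 : F) else 0) + 3 * (if Disjoint E (A : Finset α) then (1 : F) else 0)) +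
            v₀ A * (if Disjoint E (A : Finset α) then (1 : F) else 0)) = 0) by
    have hnn : (0 : ℤ) ≤ ∑ A : 𝒜, ((a A) ^ 2 + (b A) ^ 2) := sum_nonneg fun A _ => by positivity
    exact H (∑ A : 𝒜, ((a A) ^ 2 + (b A) ^ 2)).toNat a b (by rw [Int.toNat_of_nonneg hnn]) hab hPQ
  intro n
  induction n with
  | zero =>
    intro a b hle hab _
    exfalso
    obtain ⟨A, hA⟩ := hab
    have h1 : (a A) ^ 2 + (b A) ^ 2 ≤ ∑ B : 𝒜, ((a B) ^ 2 + (b B) ^ 2) :=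
      single_le_sum (f := fun B : ↥𝒜 => (a B) ^ 2 + (b B) ^ 2) (fun B _ => by positivity) (mem_univ A)
    have h2 : (a A) ^ 2 + (b A) ^ 2 ≤ 0 := by push_cast at hle; linarith
    rcases hA with h | h
    · have : 0 < (a A) ^ 2 := by positivity
      nlinarith [sq_nonneg (b A)]
    · have : 0 < (b A) ^ 2 := by positivity
      nlinarith [sq_nonneg (a A)]
  | succ n ih =>
    intro a b hle hab hz
    by_cases hndvd : ∃ A, ¬ ((5 : ℤ) ∣ a A + 3 * b A)
    · -- reduce: t ↦ 3 + ε (mod ε²)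
      obtain ⟨A0, hA0⟩ := hndvd
      refine ⟨fun A => ((a A + 3 * b A : ℤ) : F), fun A => ((b A : ℤ) : F), ?_, ?_, ?_⟩
      · intro hw
        have h0 := congr_fun hw A0
        simp only [Pi.zero_apply] at h0
        exact hA0 ((CharP.intCast_eq_zero_iff F 5 _).mp h0)
      · intro E hE
        obtain ⟨h1, h2⟩ := hz E hE
        have h5 : ((5 : ℤ) : F) = 0 := by exact_mod_cast CharP.cast_eq_zero F 5
        have e : ∑ A : 𝒜, (((a A + 3 * b A : ℤ)) : F) *
            ((if E ⊆ (A : Finset α) then (1 : F) else 0) + 3 * (if Disjoint E (A : Finset α) then (1 : F) else 0)) =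
            ((∑ A : 𝒜, (a A * zI A E + b A * yI A E) : ℤ) : F) +
              3 * ((∑ A : 𝒜, (a A * yI A E + b A * zI A E + b A * yI A E) : ℤ) : F) +
              ((5 : ℤ) : F) * ∑ A : 𝒜, ((b A : ℤ) : F) * (if Disjoint E (A : Finset α) then (1 : F) else 0) := by
          push_cast [zI, yI]
          rw [mul_sum, mul_sum, ← sum_add_distrib, ← sum_add_distrib]
          refine sum_congr rfl fun A _ => ?_
          ring
        rw [e, h1, h2, h5]
        push_cast
        ring
      · intro E hE
        obtain ⟨h1, h2⟩ := hz E hE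
        have h5 : ((5 : ℤ) : F) = 0 := by exact_mod_cast CharP.cast_eq_zero F 5
        have e : ∑ A : 𝒜, (((b A : ℤ) : F) *
            ((if E ⊆ (A : Finset α) then (1 : F) else 0) + 3 * (if Disjoint E (A : Finset α) then (1 : F) else 0)) +
              (((a A + 3 * b A : ℤ)) : F) * (if Disjoint E (A : Finset α) then (1 : F) else 0)) =
            ((∑ A : 𝒜, (a A * yI A E + b A * zI A E + b A * yI A E) : ℤ) : F) +
              ((5 : ℤ) : F) * ∑ A : 𝒜, ((b A : ℤ) : F) * (if Disjoint E (A : Finset α) then (1 : F) else 0) := by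
          push_cast [zI, yI]
          rw [mul_sum, ← sum_add_distrib]
          refine sum_congr rfl fun A _ => ?_
          ring
        rw [e, h2, h5]
        push_cast
        ring
    · -- all a_A + 3 b_A divisible by 5: divide the vector by √5 = 2t - 1 and recurse
      push Not at hndvd
      -- a' = (2b - a)/5, b' = (2a + b)/5
      have hdvd1 : ∀ A, (5 : ℤ) ∣ 2 * b A - a A := by
        intro A; obtain ⟨k, hk⟩ := hndvd A; exact ⟨b A - k, by linarith⟩
      have hdvd2 : ∀ A, (5 : ℤ) ∣ 2 * a A + b A := by
        intro A; obtain ⟨k, hk⟩ := hndvd A; exact ⟨2 * k - b A, by linarith⟩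
      let a' : ↥𝒜 → ℤ := fun A => (2 * b A - a A) / 5
      let b' : ↥𝒜 → ℤ := fun A => (2 * a A + b A) / 5
      have ha5 : ∀ A, 5 * a' A = 2 * b A - a A := fun A => Int.mul_ediv_cancel' (hdvd1 A)
      have hb5 : ∀ A, 5 * b' A = 2 * a A + b A := fun A => Int.mul_ediv_cancel' (hdvd2 A)
      have ha : ∀ A, a A = 2 * b' A - a' A := by intro A; have := ha5 A; have := hb5 A; omega
      have hb : ∀ A, b A = 2 * a' A + b' A := by intro A; have := ha5 A; have := hb5 A; omega
      obtain ⟨A0, hA0⟩ := hab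
      have hA0' : a' A0 ≠ 0 ∨ b' A0 ≠ 0 := by
        by_contra h
        push Not at h
        have h1 := ha A0; have h2 := hb A0
        rw [h.1, h.2] at h1 h2
        rcases hA0 with h' | h'
        · exact h' (by omega)
        · exact h' (by omega)
      have hab' : ∃ A, a' A ≠ 0 ∨ b' A ≠ 0 := ⟨A0, hA0'⟩
      -- the measure drops: a² + b² = 5 (a'² + b'²)
      have hsq : ∀ A, (a A) ^ 2 + (b A) ^ 2 = 5 * ((a' A) ^ 2 + (b' A) ^ 2) := by
        intro A; rw [ha A, hb A]; ring
      have hle' : ∑ A : 𝒜, ((a' A) ^ 2 + (b' A) ^ 2) ≤ (n : ℤ) := by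
        have e : ∑ A : 𝒜, ((a A) ^ 2 + (b A) ^ 2) = 5 * ∑ A : 𝒜, ((a' A) ^ 2 + (b' A) ^ 2) := by
          rw [mul_sum]; exact sum_congr rfl fun A _ => hsq A
        rw [e] at hle
        have hpos : 1 ≤ ∑ A : 𝒜, ((a' A) ^ 2 + (b' A) ^ 2) := by
          have h1 : (a' A0) ^ 2 + (b' A0) ^ 2 ≤ ∑ B : 𝒜, ((a' B) ^ 2 + (b' B) ^ 2) :=
            single_le_sum (f := fun B : ↥𝒜 => (a' B) ^ 2 + (b' B) ^ 2) (fun B _ => by positivity) (mem_univ A0)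
          have h2 : 1 ≤ (a' A0) ^ 2 + (b' A0) ^ 2 := by
            rcases hA0' with h | h
            · have : 0 < (a' A0) ^ 2 := by positivity
              nlinarith [sq_nonneg (b' A0)]
            · have : 0 < (b' A0) ^ 2 := by positivity
              nlinarith [sq_nonneg (a' A0)]
          linarith
        push_cast at hle
        linarith
      -- the integer identities persist: 5·(I') = 2(II) − (I), 5·(II') = 2(I) + (II)
      have hz' : ∀ E ∈ 𝒜 \\ 𝒜, (∑ A : 𝒜, (a' A * zI A E + b' A * yI A E) = 0) ∧
          (∑ A : 𝒜, (a' A * yI A E + b' A * zI A E + b' A * yI A E) = 0) := by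
        intro E hE
        obtain ⟨h1, h2⟩ := hz E hE
        have e1 : 5 * ∑ A : 𝒜, (a' A * zI A E + b' A * yI A E) =
            2 * ∑ A : 𝒜, (a A * yI A E + b A * zI A E + b A * yI A E) - ∑ A : 𝒜, (a A * zI A E + b A * yI A E) := by
          rw [mul_sum, mul_sum, ← sum_sub_distrib]
          refine sum_congr rfl fun A _ => ?_
          rw [ha A, hb A]
          ring
        have e2 : 5 * ∑ A : 𝒜, (a' A * yI A E + b' A * zI A E + b' A * yI A E) =
            2 * ∑ A : 𝒜, (a A * zI A E + b A * yI A E) + ∑ A : 𝒜, (a A * yI A E + b A * zI A E + b A * yI A E) := by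
          rw [mul_sum, mul_sum, ← sum_add_distrib]
          refine sum_congr rfl fun A _ => ?_
          rw [ha A, hb A]
          ring
        rw [h1, h2] at e1 e2
        constructor
        · have : 5 * ∑ A : 𝒜, (a' A * zI A E + b' A * yI A E) = 0 := by rw [e1]; ring
          exact (mul_eq_zero.mp this).resolve_left (by norm_num)
        · have : 5 * ∑ A : 𝒜, (a' A * yI A E + b' A * zI A E + b' A * yI A E) = 0 := by rw [e2]; ring
          exact (mul_eq_zero.mp this).resolve_left (by norm_num)
      exact ih a' b' hle' hab' hz'

/-- **The tangential certificate: no Jordan chain of length two at `θ = 3` over `𝔽₅` ⟹ (C0) at the golden ratio.**  Let `F` be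
a field of characteristic `5` and suppose the pencil of `𝒜` has no LEFT JORDAN CHAIN of length two at `t = 3`: whenever
`v₀ (Z + 3Y) = 0` and `v₁ (Z + 3Y) + v₀ Y = 0` on `𝒜 \\ 𝒜`, `v₀ = 0` (a condition strictly weaker than `rank_{𝔽₅} U(3) = |𝒜|`:
simple eigenvectors at `3` are allowed).  Then for every field `K` of characteristic `0` and every `t` with `t * t = t + 1` the
pencil rows of `𝒜` at `t` are linearly independent over `K`. -/
theorem linearIndependent_pencil_golden_of_tangent_certificate_five (𝒜 : Finset (Finset α))
    {F : Type*} [Field F] [CharP F 5]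
    (hF : ∀ v₀ v₁ : ↥𝒜 → F,
      (∀ E ∈ 𝒜 \\ 𝒜, ∑ A : 𝒜, v₀ A *
        ((if E ⊆ (A : Finset α) then (1 : F) else 0) + 3 * (if Disjoint E (A : Finset α) then (1 : F) else 0)) = 0) →
      (∀ E ∈ 𝒜 \\ 𝒜, ∑ A : 𝒜, (v₁ A *
        ((if E ⊆ (A : Finset α) then (1 : F) else 0) + 3 * (if Disjoint E (A : Finset α) then (1 : F) else 0)) +
          v₀ A * (if Disjoint E (A : Finset α) then (1 : F) else 0)) = 0) →
      v₀ = 0)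
    {K : Type*} [Field K] [CharZero K] {t : K} (ht : t * t = t + 1) :
    LinearIndependent K (fun A : 𝒜 => fun E : (𝒜 \\ 𝒜 : Finset (Finset α)) =>
      (if (E : Finset α) ⊆ (A : Finset α) then (1 : K) else 0) +
        t * (if Disjoint (E : Finset α) (A : Finset α) then (1 : K) else 0)) := by
  classical
  set R : Subalgebra ℤ K := Algebra.adjoin ℤ ({t} : Set K) with hR
  have htR : t ∈ R := Algebra.subset_adjoin (Set.mem_singleton t)
  let vR : ↥𝒜 → (𝒜 \\ 𝒜 : Finset (Finset α)) → R := fun A E =>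
    ⟨(if (E : Finset α) ⊆ (A : Finset α) then (1 : K) else 0) +
        t * (if Disjoint (E : Finset α) (A : Finset α) then (1 : K) else 0),
      R.add_mem (by split_ifs <;> simp [R.one_mem, R.zero_mem]) (R.mul_mem htR (by split_ifs <;> simp [R.one_mem, R.zero_mem]))⟩
  have hv : (fun A : ↥𝒜 => algebraMap R K ∘ vR A) = (fun A : 𝒜 => fun E : (𝒜 \\ 𝒜 : Finset (Finset α)) =>
      (if (E : Finset α) ⊆ (A : Finset α) then (1 : K) else 0) +
        t * (if Disjoint (E : Finset α) (A : Finset α) then (1 : K) else 0)) := by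
    funext A E
    rfl
  rw [← hv, linearIndependent_algebraMap_comp_iff]
  by_contra hdepR
  obtain ⟨g, hg, A0, hA0⟩ := Fintype.not_linearIndependent_iff.mp hdepR
  have hcoef : ∀ A : ↥𝒜, ∃ ab : ℤ × ℤ, ((g A : R) : K) = (ab.1 : K) + (ab.2 : K) * t := by
    intro A
    obtain ⟨a, b, h⟩ := exists_int_add_int_mul_of_mem_adjoin ht (g A).2
    exact ⟨(a, b), h⟩
  choose ab hab using hcoef
  have hK : ∀ a b : ℤ, (a : K) + (b : K) * t = 0 → a = 0 ∧ b = 0 := fun a b h => int_eq_zero_of_golden ht a b h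
  have hne : ∃ A, (ab A).1 ≠ 0 ∨ (ab A).2 ≠ 0 := by
    refine ⟨A0, ?_⟩
    by_contra h
    push Not at h
    apply hA0
    have e : ((g A0 : R) : K) = 0 := by rw [hab A0, h.1, h.2]; simp
    exact Subtype.ext e
  have hdep : ∀ E ∈ 𝒜 \\ 𝒜, ∑ A : 𝒜, (((ab A).1 : K) + ((ab A).2 : K) * t) *
      ((if E ⊆ (A : Finset α) then (1 : K) else 0) + t * (if Disjoint E (A : Finset α) then (1 : K) else 0)) = 0 := by
    intro E hE
    have h := congr_fun hg ⟨E, hE⟩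
    simp only [Finset.sum_apply, Pi.smul_apply, smul_eq_mul, Pi.zero_apply] at h
    have h' : (((∑ i : ↥𝒜, g i * vR i ⟨E, hE⟩ : R)) : K) = 0 := by rw [h]; rfl
    have e : ∑ A : 𝒜, (((ab A).1 : K) + ((ab A).2 : K) * t) *
        ((if E ⊆ (A : Finset α) then (1 : K) else 0) + t * (if Disjoint E (A : Finset α) then (1 : K) else 0)) =
        (((∑ i : ↥𝒜, g i * vR i ⟨E, hE⟩ : R)) : K) := by
      push_cast
      refine sum_congr rfl fun A _ => ?_
      rw [hab A]
    rw [e, h']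
  obtain ⟨v₀, v₁, hv0, h1, h2⟩ := exists_tangent_chain_of_integral_dependency_golden 𝒜 ht hK (F := F)
    (fun A => (ab A).1) (fun A => (ab A).2) hne hdep
  exact hv0 (hF v₀ v₁ h1 h2)

end OrderedDifferences

end Summit.CriticalPhenomena.PercolationContinuityZ3.Theorems
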